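import Literature.RepresentationTheory.FiniteGroups.ProductGroupCharacters
import Literature.RepresentationTheory.FiniteGroups.RepresentationRing
import Literature.RepresentationTheory.FiniteGroups.SymmetricGroupIsotypic
import HarnessLib

/-!
# The irreducible characters of a finite direct product `Π i, G i`, and class functions on a
# Young subgroup `𝔖_{n₁} × ⋯ × 𝔖_{n_d}`

Topic `Literature/RepresentationTheory/FiniteGroups`.  Serre, *Linear Representations of Finite
Groups*, §3.2 Thm. 10, for a FINITE family of finite groups `G i` (`i : ι`, `ι` finite): the
irreducible characters of `Π i, G i` are exactly the external products
`⊠ χ• : y ↦ ∏ i, χ•ᵢ(yᵢ)` of irreducible characters `χ•ᵢ` of the factors, each occurring once.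
The sibling `ProductGroupCharacters.lean` has the binary case `K × L`; the proofs here are the same
counting-free argument through the regular character (`r_{Π G} = ⊠ r_{Gᵢ} = ∑_{χ•} (∏ χ•ᵢ(1)) ⊠χ•`
and `⟨r, χ⟩ = χ(1) ≠ 0`), written for the `Π`-type.

* `IsCharacter.finset_prod`, `IsCharacter.piBox` — products of characters, `⊠χ•` is a character;
* `classInner_piBox` — `⟨⊠χ•, ⊠χ•'⟩ = ∏ᵢ ⟨χ•ᵢ, χ•'ᵢ⟩`; `IsIrrChar.piBox` — (i);
* `character_leftRegular_pi`, `exists_eq_piBox_of_mem_irrChars` — (ii); `irrChars_pi_eq`,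
  `piBox_injective_of_isIrrChar` (each irreducible character arises from ONE tuple).
* Young subgroups (`G i = 𝔖_{nᵢ}`, the tree's `irrChars_perm_eq`: `Irr 𝔖ₙ = {χ^μ}`):
  `irrChars_pi_perm_eq` — `Irr(𝔖_{n₁} × ⋯ × 𝔖_{n_d}) = {y ↦ ∏ᵢ χ^{μⁱ}(yᵢ) : μⁱ ⊢ nᵢ}`;
  `prodSpechtCharacter_injective`; the Fourier expansion of a class function on the Young subgroup
  `IsClassFun.eq_sum_classInner_prodSpecht` (`f = ∑_{μ•} ⟨f, ⊠χ^{μ•}⟩ ⊠χ^{μ•}`, Serre §2.5 Thm. 6 with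
  §3.2 Thm. 10), and its instance for a restricted Specht character `χ^λ ∘ ψ` along any homomorphism
  `ψ : 𝔖_{n₁} × ⋯ × 𝔖_{n_d} → 𝔖_N` (`spechtCharacter_comp_eq_sum`: `χ^λ(ψ y) = ∑_{μ•} c^λ_{μ•} ∏ᵢ χ^{μⁱ}(yᵢ)`
  with `c^λ_{μ•} = ⟨χ^λ ∘ ψ, ⊠χ^{μ•}⟩`, the multi-Littlewood–Richardson numbers when `ψ` is the
  Young-subgroup embedding — brick (B3) of the `val-lit` route to Ikenmeyer–Kandasamy Prop. 10.1).

Everything is proved; no definition is introduced (the external product is written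
`fun y => ∏ i, χ i (y i)`). Honest framing: finite-group bookkeeping; nothing here bears on VP vs VNP.

## References

* J.-P. Serre, *Linear Representations of Finite Groups*, GTM 42 (1977), §2.4 Prop. 5 and Cor. 1,
  §2.5 Thm. 6, §3.2 Thm. 10 [SerreLinearRepresentations1977].
* G. James, M. Liebeck, *Representations and Characters of Groups* (2001), Thm. 19.18.
* W. Fulton, J. Harris, GTM 129, Thm. 4.3 (the `χ^μ` exhaust `Irr 𝔖ₙ`) [FultonHarrisGTM129].
-/

noncomputable section

open scoped BigOperators
open Module
open Literature.NumberTheory.DiophantineGeometry (spechtCharacter)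

namespace Literature.RepresentationTheory.FiniteGroups

/-! ### Products of characters -/

section Products

variable {G : Type} [Group G]

/-- A finite product of characters is a character (tensor products; Serre §1.5).
[cite: SerreLinearRepresentations1977, §1.5] -/
theorem IsCharacter.finset_prod {α : Type*} (s : Finset α) {f : α → G → ℂ}
    (h : ∀ a ∈ s, IsCharacter G (f a)) : IsCharacter G (∏ a ∈ s, f a) := by
  classical
  induction s using Finset.induction_on with
  | empty => simpa using (isCharacter_one (G := G))
  | insert a s ha ih =>
    rw [Finset.prod_insert ha]
    exact (h a (Finset.mem_insert_self a s)).mul (ih fun b hb => h b (Finset.mem_insert_of_mem hb))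

/-- The pull-back of a character along a homomorphism is a character (restriction / inflation;
Serre §1.1). [cite: SerreLinearRepresentations1977, §1.1] -/
private theorem IsCharacter.comp_hom {K : Type} [Group K] (f : G →* K) {χ : K → ℂ}
    (hχ : IsCharacter K χ) : IsCharacter G (χ ∘ f) := by
  obtain ⟨V, _, _, _, ρ, rfl⟩ := hχ
  exact ⟨V, _, _, inferInstance, ρ.comp f, rfl⟩

/-- The pull-back of a class function along a homomorphism is a class function. [folklore] -/
private theorem IsClassFun.comp_hom {K : Type} [Group K] {f : K → ℂ} (hf : IsClassFun f)
    (φ : G →* K) : IsClassFun (f ∘ φ) := by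
  intro s t
  simp only [Function.comp_apply, map_mul, map_inv]
  exact hf (φ s) (φ t)

end Products

/-! ### External products over a finite family -/

section PiBox

variable {ι : Type} [Fintype ι] {G : ι → Type} [∀ i, Group (G i)]

/-- **The external product `⊠χ• : y ↦ ∏ᵢ χ•ᵢ(yᵢ)` of characters is a character of `Π i, G i`**
(the tensor product of the characters inflated along the projections).
[cite: SerreLinearRepresentations1977, §3.2 Thm. 10] -/
theorem IsCharacter.piBox {χ : ∀ i, G i → ℂ} (hχ : ∀ i, IsCharacter (G i) (χ i)) :
    IsCharacter (∀ i, G i) (fun y => ∏ i, χ i (y i)) := by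
  have h : (fun y : ∀ i, G i => ∏ i, χ i (y i)) =
      ∏ i, (χ i ∘ (Pi.evalMonoidHom G i : (∀ i, G i) →* G i)) := by
    funext y
    rw [Finset.prod_apply]
    rfl
  rw [h]
  exact IsCharacter.finset_prod _ fun i _ => IsCharacter.comp_hom _ (hχ i)

/-- The external product of class functions is a class function (Serre §3.2: `χ₁(s₁)·χ₂(s₂)` is a
class function on the product). [cite: SerreLinearRepresentations1977, §3.2 Thm. 10] -/
theorem IsClassFun.piBox {χ : ∀ i, G i → ℂ} (hχ : ∀ i, IsClassFun (χ i)) :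
    IsClassFun (fun y : ∀ i, G i => ∏ i, χ i (y i)) := by
  intro s t
  exact Finset.prod_congr rfl fun i _ => hχ i (s i) (t i)

/-- The degree of an external product is the product of the degrees (Serre §3.2 (ii): the degree
of `ρ₁ ⊗ ρ₂` is the product of the degrees). [cite: SerreLinearRepresentations1977, §3.2 Thm. 10] -/
theorem piBox_apply_one (χ : ∀ i, G i → ℂ) :
    (fun y : ∀ i, G i => ∏ i, χ i (y i)) 1 = ∏ i, χ i 1 := rfl

variable [DecidableEq ι] [∀ i, Fintype (G i)]

/-- **`⟨⊠χ•, ⊠χ•'⟩_{Π G} = ∏ᵢ ⟨χ•ᵢ, χ•'ᵢ⟩_{Gᵢ}`** (the sum over `Π i, G i` of a product factorises;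
the computation in Serre's proof of §3.2 Thm. 10 (i)). [cite: SerreLinearRepresentations1977, §3.2 Thm. 10] -/
theorem classInner_piBox (χ χ' : ∀ i, G i → ℂ) :
    classInner (fun y : ∀ i, G i => ∏ i, χ i (y i)) (fun y => ∏ i, χ' i (y i)) =
      ∏ i, classInner (χ i) (χ' i) := by
  simp only [classInner_apply]
  rw [Finset.prod_mul_distrib, Finset.prod_inv_distrib, Fintype.card_pi, Nat.cast_prod,
    Fintype.prod_sum fun i (t : G i) => χ i t * χ' i t⁻¹]
  congr 1
  refine Finset.sum_congr rfl fun y _ => ?_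
  rw [← Finset.prod_mul_distrib]
  rfl

/-- **Serre §3.2 Thm. 10 (i) for finite products: the external product of irreducible characters
is an irreducible character of `Π i, G i`** (`⟨⊠χ•, ⊠χ•⟩ = ∏ᵢ ⟨χ•ᵢ, χ•ᵢ⟩ = 1`).
[cite: SerreLinearRepresentations1977, §3.2 Thm. 10] -/
theorem IsIrrChar.piBox {χ : ∀ i, G i → ℂ} (hχ : ∀ i, IsIrrChar (G i) (χ i)) :
    IsIrrChar (∀ i, G i) (fun y => ∏ i, χ i (y i)) := by
  refine (IsCharacter.piBox fun i => (hχ i).isCharacter).isIrrChar_of_classInner_eq_one ?_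
  rw [classInner_piBox]
  exact Finset.prod_eq_one fun i _ => by rw [(hχ i).classInner_eq (hχ i), if_pos rfl]

/-- Membership form of (i): `⊠χ• ∈ Irr(Π i, G i)` for `χ•ᵢ ∈ Irr(Gᵢ)`.
[cite: SerreLinearRepresentations1977, §3.2 Thm. 10] -/
theorem piBox_mem_irrChars {χ : ∀ i, G i → ℂ} (hχ : ∀ i, χ i ∈ irrChars (G i)) :
    (fun y : ∀ i, G i => ∏ i, χ i (y i)) ∈ irrChars (∀ i, G i) :=
  IsIrrChar.piBox hχ

/-- **Distinct tuples of irreducible characters have distinct external products**: if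
`⊠χ• = ⊠χ•'` then `1 = ⟨⊠χ•, ⊠χ•'⟩ = ∏ᵢ ⟨χ•ᵢ, χ•'ᵢ⟩` forces `χ•ᵢ = χ•'ᵢ` for every `i`
(orthonormality). [cite: SerreLinearRepresentations1977, §3.2 Thm. 10] -/
theorem piBox_injective_of_isIrrChar {χ χ' : ∀ i, G i → ℂ} (hχ : ∀ i, IsIrrChar (G i) (χ i))
    (hχ' : ∀ i, IsIrrChar (G i) (χ' i))
    (h : (fun y : ∀ i, G i => ∏ i, χ i (y i)) = fun y => ∏ i, χ' i (y i)) : χ = χ' := by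
  classical
  have h1 : classInner (fun y : ∀ i, G i => ∏ i, χ i (y i)) (fun y => ∏ i, χ' i (y i)) = 1 := by
    rw [← h, (IsIrrChar.piBox hχ).classInner_eq (IsIrrChar.piBox hχ), if_pos rfl]
  rw [classInner_piBox] at h1
  funext i
  by_contra hne
  have h0 : ∏ j, classInner (χ j) (χ' j) = 0 :=
    Finset.prod_eq_zero (Finset.mem_univ i) (by rw [(hχ i).classInner_eq (hχ' i), if_neg hne])
  rw [h0] at h1
  exact zero_ne_one h1

/-! ### Completeness through the regular character -/

/-- The regular character of `Π i, G i` is the external product of the regular characters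
(Serre §2.4 Prop. 5: `r(1) = |G|`, `r(s) = 0` otherwise; `|Π G| = ∏ |Gᵢ|`).
[cite: SerreLinearRepresentations1977, §2.4 Prop. 5] -/
theorem character_leftRegular_pi (y : ∀ i, G i) :
    (Representation.leftRegular ℂ (∀ i, G i)).character y =
      ∏ i, (Representation.leftRegular ℂ (G i)).character (y i) := by
  classical
  rw [character_leftRegular]
  simp only [character_leftRegular]
  by_cases hy : y = 1
  · subst hy
    simp only [Pi.one_apply, if_true, Fintype.card_pi, Nat.cast_prod]
  · rw [if_neg hy]
    obtain ⟨i, hi⟩ : ∃ i, y i ≠ 1 := by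
      by_contra hall
      exact hy (funext fun i => Classical.not_not.mp (not_exists.mp hall i))
    exact (Finset.prod_eq_zero (Finset.mem_univ i) (if_neg hi)).symm

/-- The regular character of `Π i, G i` expanded along the external products of irreducible
characters: `r_{Π G} = ∑_{χ• ∈ Π Irr(Gᵢ)} (∏ᵢ χ•ᵢ(1)) · ⊠χ•`. [cite: SerreLinearRepresentations1977, §3.2 Thm. 10] -/
theorem character_leftRegular_pi_eq_sum :
    (Representation.leftRegular ℂ (∀ i, G i)).character =
      ∑ χ ∈ Fintype.piFinset fun i => (irrChars_finite_holds (G i)).toFinset,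
        (∏ i, χ i 1) • fun y : ∀ i, G i => ∏ i, χ i (y i) := by
  classical
  funext y
  rw [character_leftRegular_pi]
  simp only [character_leftRegular_eq_sum_smul, Finset.sum_apply, Pi.smul_apply, smul_eq_mul]
  rw [Finset.prod_univ_sum (fun i => (irrChars_finite_holds (G i)).toFinset)
    (fun i (ψ : G i → ℂ) => ψ 1 * ψ (y i))]
  refine Finset.sum_congr rfl fun χ _ => ?_
  rw [Finset.prod_mul_distrib]

/-- **Serre §3.2 Thm. 10 (ii) for finite products: every irreducible character of `Π i, G i` is an
external product `⊠χ•` of irreducible characters** — otherwise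
`χ(1) = ⟨r_{Π G}, χ⟩ = ∑_{χ•} (∏ χ•ᵢ(1)) ⟨⊠χ•, χ⟩` would vanish by orthonormality.
[cite: SerreLinearRepresentations1977, §3.2 Thm. 10] -/
theorem exists_eq_piBox_of_mem_irrChars {χ : (∀ i, G i) → ℂ} (hχ : χ ∈ irrChars (∀ i, G i)) :
    ∃ ψ : ∀ i, G i → ℂ, (∀ i, ψ i ∈ irrChars (G i)) ∧ χ = fun y => ∏ i, ψ i (y i) := by
  classical
  have hχi : IsIrrChar (∀ i, G i) χ := hχ
  by_contra hne
  apply hχi.apply_one_ne_zero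
  rw [← classInner_leftRegular χ, character_leftRegular_pi_eq_sum, classInner_sum_left]
  refine Finset.sum_eq_zero fun ψ hψ => ?_
  have hψ' : ∀ i, IsIrrChar (G i) (ψ i) := fun i =>
    (irrChars_finite_holds (G i)).mem_toFinset.mp (Fintype.mem_piFinset.mp hψ i)
  rw [classInner_smul_left, (IsIrrChar.piBox hψ').classInner_eq hχi,
    if_neg (fun h => hne ⟨ψ, hψ', h.symm⟩), mul_zero]

/-- **`Irr(Π i, G i) = {⊠χ• : χ•ᵢ ∈ Irr(Gᵢ)}`** (Serre §3.2 Thm. 10 / James–Liebeck Thm. 19.18 for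
finite products). [cite: SerreLinearRepresentations1977, §3.2 Thm. 10] -/
theorem irrChars_pi_eq :
    irrChars (∀ i, G i) =
      {χ | ∃ ψ : ∀ i, G i → ℂ, (∀ i, ψ i ∈ irrChars (G i)) ∧ χ = fun y => ∏ i, ψ i (y i)} := by
  ext χ
  constructor
  · exact exists_eq_piBox_of_mem_irrChars
  · rintro ⟨ψ, hψ, rfl⟩
    exact piBox_mem_irrChars hψ

/-- Finset form: the finite set of irreducible characters of `Π i, G i` is the image of the product
of the finite sets `Irr(Gᵢ)` under `⊠`. [cite: SerreLinearRepresentations1977, §3.2 Thm. 10] -/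
theorem irrChars_toFinset_pi_eq_image [DecidableEq ((∀ i, G i) → ℂ)] :
    (irrChars_finite_holds (∀ i, G i)).toFinset =
      (Fintype.piFinset fun i => (irrChars_finite_holds (G i)).toFinset).image
        fun ψ : ∀ i, G i → ℂ => fun y : ∀ i, G i => ∏ i, ψ i (y i) := by
  ext χ
  simp only [Set.Finite.mem_toFinset, Finset.mem_image, Fintype.mem_piFinset]
  constructor
  · intro hχ
    obtain ⟨ψ, hψ, rfl⟩ := exists_eq_piBox_of_mem_irrChars hχ
    exact ⟨ψ, hψ, rfl⟩
  · rintro ⟨ψ, hψ, rfl⟩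
    exact piBox_mem_irrChars hψ

end PiBox

/-! ### Young subgroups `𝔖_{n₁} × ⋯ × 𝔖_{n_d}`: irreducible characters and Fourier expansion -/

section Young

variable {ι : Type} [Fintype ι] [DecidableEq ι] {n : ι → ℕ}

/-- **The irreducible characters of a Young subgroup**:
`Irr(Π i, 𝔖_{nᵢ}) = {y ↦ ∏ᵢ χ^{μⁱ}(yᵢ) : μⁱ ⊢ nᵢ}` (Serre §3.2 Thm. 10 with `Irr 𝔖ₙ = {χ^μ : μ ⊢ n}`,
Fulton–Harris Thm. 4.3 / the tree's `irrChars_perm_eq`). [cite: SerreLinearRepresentations1977, §3.2 Thm. 10] -/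
theorem irrChars_pi_perm_eq :
    irrChars (∀ i, Equiv.Perm (Fin (n i))) =
      Set.range fun μ : ∀ i, Nat.Partition (n i) =>
        fun y : ∀ i, Equiv.Perm (Fin (n i)) => ∏ i, spechtCharacter ℂ (μ i) (y i) := by
  rw [irrChars_pi_eq]
  ext χ
  constructor
  · rintro ⟨ψ, hψ, rfl⟩
    have hμ : ∀ i, ∃ μ : Nat.Partition (n i), spechtCharacter ℂ μ = ψ i := fun i => by
      have := hψ i
      rw [irrChars_perm_eq] at this
      exact this
    choose μ hμ using hμ
    refine ⟨μ, funext fun y => Finset.prod_congr rfl fun i _ => by rw [hμ i]⟩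
  · rintro ⟨μ, rfl⟩
    exact ⟨fun i => spechtCharacter ℂ (μ i), fun i => isIrrChar_spechtCharacter (μ i), rfl⟩

/-- `y ↦ ∏ᵢ χ^{μⁱ}(yᵢ)` is an irreducible character of the Young subgroup.
[cite: SerreLinearRepresentations1977, §3.2 Thm. 10] -/
theorem isIrrChar_prodSpechtCharacter (μ : ∀ i, Nat.Partition (n i)) :
    IsIrrChar (∀ i, Equiv.Perm (Fin (n i)))
      (fun y : ∀ i, Equiv.Perm (Fin (n i)) => ∏ i, spechtCharacter ℂ (μ i) (y i)) :=
  IsIrrChar.piBox fun i => isIrrChar_spechtCharacter (μ i)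

/-- Distinct tuples of partitions give distinct characters `⊠χ^{μ•}` of the Young subgroup.
[cite: SerreLinearRepresentations1977, §3.2 Thm. 10] -/
theorem prodSpechtCharacter_injective :
    Function.Injective fun μ : ∀ i, Nat.Partition (n i) =>
      fun y : ∀ i, Equiv.Perm (Fin (n i)) => ∏ i, spechtCharacter ℂ (μ i) (y i) := by
  intro μ μ' h
  have key := piBox_injective_of_isIrrChar (fun i => isIrrChar_spechtCharacter (μ i))
    (fun i => isIrrChar_spechtCharacter (μ' i)) h
  funext i
  exact spechtCharacter_injective (congr_fun key i)

/-- `⟨⊠χ^{μ•}, ⊠χ^{μ•'}⟩ = [μ• = μ•']` (orthonormality of the irreducible characters of the Young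
subgroup, Serre §2.3 Thm. 3 with §3.2 Thm. 10). [cite: SerreLinearRepresentations1977, §2.3 Thm. 3] -/
theorem classInner_prodSpechtCharacter (μ μ' : ∀ i, Nat.Partition (n i)) :
    classInner (fun y : ∀ i, Equiv.Perm (Fin (n i)) => ∏ i, spechtCharacter ℂ (μ i) (y i))
        (fun y => ∏ i, spechtCharacter ℂ (μ' i) (y i)) = if μ = μ' then 1 else 0 := by
  classical
  rw [(isIrrChar_prodSpechtCharacter μ).classInner_eq (isIrrChar_prodSpechtCharacter μ')]
  by_cases h : μ = μ'
  · subst h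
    rw [if_pos rfl, if_pos rfl]
  · rw [if_neg h, if_neg (fun e => h (prodSpechtCharacter_injective e))]

/-- **Fourier expansion of a class function on a Young subgroup**:
`f = ∑_{μ• : Π μⁱ ⊢ nᵢ} ⟨f, ⊠χ^{μ•}⟩ · ⊠χ^{μ•}` (Serre §2.5 Thm. 6 — the irreducible characters are an
orthonormal basis of class functions — indexed through §3.2 Thm. 10 and `Irr 𝔖ₙ = {χ^μ}`).
[cite: SerreLinearRepresentations1977, §2.5 Thm. 6] -/
theorem IsClassFun.eq_sum_classInner_prodSpecht {f : (∀ i, Equiv.Perm (Fin (n i))) → ℂ}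
    (hf : IsClassFun f) :
    f = ∑ μ : ∀ i, Nat.Partition (n i),
      classInner f (fun y => ∏ i, spechtCharacter ℂ (μ i) (y i)) •
        fun y : ∀ i, Equiv.Perm (Fin (n i)) => ∏ i, spechtCharacter ℂ (μ i) (y i) := by
  classical
  have hF : (irrChars_finite_holds (∀ i, Equiv.Perm (Fin (n i)))).toFinset =
      Finset.univ.image fun μ : ∀ i, Nat.Partition (n i) =>
        fun y : ∀ i, Equiv.Perm (Fin (n i)) => ∏ i, spechtCharacter ℂ (μ i) (y i) := by
    ext χ
    rw [Set.Finite.mem_toFinset, Finset.mem_image, irrChars_pi_perm_eq, Set.mem_range]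
    simp
  conv_lhs => rw [hf.eq_sum_classInner_smul, hF]
  rw [Finset.sum_image fun μ _ μ' _ h => prodSpechtCharacter_injective h]

/-- **Restriction of a Specht character to a Young subgroup, expanded** (brick (B3) of the
`val-lit` route to Ikenmeyer–Kandasamy 2020 Prop. 10.1): for any homomorphism
`ψ : Π i, 𝔖_{nᵢ} → 𝔖_N` (e.g. the block embedding of a Young subgroup) and `λ ⊢ N`,
`χ^λ(ψ y) = ∑_{μ•} c^λ_{μ•} ∏ᵢ χ^{μⁱ}(yᵢ)` with `c^λ_{μ•} = ⟨χ^λ ∘ ψ, ⊠χ^{μ•}⟩` (for the Young embedding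
these are the multi-Littlewood–Richardson coefficients, Fulton–Harris (4.41)/Ex. 4.43).
[cite: SerreLinearRepresentations1977, §2.5 Thm. 6] [cite: FultonHarrisGTM129, §4.3 Ex. 4.43] -/
theorem spechtCharacter_comp_eq_sum {N : ℕ} (lam : Nat.Partition N)
    (ψ : (∀ i, Equiv.Perm (Fin (n i))) →* Equiv.Perm (Fin N)) :
    (spechtCharacter ℂ lam ∘ ψ : (∀ i, Equiv.Perm (Fin (n i))) → ℂ) =
      ∑ μ : ∀ i, Nat.Partition (n i),
        classInner (spechtCharacter ℂ lam ∘ ψ) (fun y => ∏ i, spechtCharacter ℂ (μ i) (y i)) •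
          fun y : ∀ i, Equiv.Perm (Fin (n i)) => ∏ i, spechtCharacter ℂ (μ i) (y i) :=
  ((isIrrChar_spechtCharacter lam).isCharacter.isClassFun.comp_hom ψ).eq_sum_classInner_prodSpecht

/-- Pointwise form of `spechtCharacter_comp_eq_sum`: `χ^λ(ψ y) = ∑_{μ•} c^λ_{μ•} ∏ᵢ χ^{μⁱ}(yᵢ)`.
[cite: SerreLinearRepresentations1977, §2.5 Thm. 6] -/
theorem spechtCharacter_apply_hom_eq_sum {N : ℕ} (lam : Nat.Partition N)
    (ψ : (∀ i, Equiv.Perm (Fin (n i))) →* Equiv.Perm (Fin N)) (y : ∀ i, Equiv.Perm (Fin (n i))) :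
    spechtCharacter ℂ lam (ψ y) =
      ∑ μ : ∀ i, Nat.Partition (n i),
        classInner (spechtCharacter ℂ lam ∘ ψ) (fun y => ∏ i, spechtCharacter ℂ (μ i) (y i)) *
          ∏ i, spechtCharacter ℂ (μ i) (y i) := by
  have h := congr_fun (spechtCharacter_comp_eq_sum lam ψ) y
  simpa only [Function.comp_apply, Finset.sum_apply, Pi.smul_apply, smul_eq_mul] using h

end Young

end Literature.RepresentationTheory.FiniteGroups

end
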